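import Summits.BirchSwinnertonDyer.BirchSwinnertonDyer.Theorems.ResidualThetaTransportAtTwoHeckeThetaPartnerAdicAtTwoHeckeThetaNewform
import Summits.BirchSwinnertonDyer.BirchSwinnertonDyer.Theorems.ResidualThetaTransportAtTwoCohomologicalPlusPeriodSupplyPeriods
import Literature.NumberTheory.EllipticCurves.ModularityVersionApProofs
import Literature.NumberTheory.EllipticCurves.Rank1Residual.Predicates
import Literature.NumberTheory.EllipticCurves.SharpFlatPAdicLFunctionCoeffField
import Literature.FieldTheory.AlgClosed.PadicAlgClEquivComplex
import HarnessLib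

/-!
# The `p`-adic Hecke theta partner at an ODD prime from its arithmetic half (socket theorem)

Route `SignedLowerHalves`, child L `SmallImageLowerHalfBothSigns` (item stmt-BirchSwinnertonDyer-23599), line
proposal `rtt_w3` (crux dir `Cruxes/SmallImageLowerHalfBothSigns/Lines/rtt_w3.lean`), stub K0₂@p
`stub_heckeThetaPartner_ns`; width seat `bsd-line-slh-p3-w3` gen 9.  THEOREMS ONLY (no definition, no named
fact, no `sorry`); ROUTE-INDEPENDENT (no `Theses` import).

This is the odd-`p` twin of the BODY of the tree's unconditional K0⁺ at `2`
(`Theorems.heckeThetaPartnerAdicAtTwo_proof`, route `ResidualThetaTransportAtTwo`): the composition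
"arithmetic half ⟹ K0-shape partner" with the GENERIC half of that proof — Ribet's weight-two CM newform on
`Γ₀(N)`, `N ∣ |d_k|·N𝔪` (tree theorem `HeckeTheta.ribet_cmNewform_gamma0_two`, any imaginary quadratic `k`,
any modulus `𝔪`) and the cohomological plus period (`CohomologicalPeriod.exists_isCohomologicalPlusPeriod`,
any `p`).  The ARITHMETIC HALF at odd `p` — an imaginary quadratic `k` with no ideal of norm `p`, an
embedding `σ`, a modulus `𝔪` with `p ∤ |d_k|·N𝔪` all of whose primes are bad primes of `W`, a ring
isomorphism `e : ℚ̄_p ≃ ℂ`, and a Größencharakter `ψ mod 𝔪` of type `σ` with trivial Nebentypus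
(`ψ̃((n)) = (d_k/n)·n` for odd `n` prime to `|d_k|·N𝔪`) whose prime sums `∑_{Nw = ℓ} ψ(w)` are congruent
to `a_ℓ(W)` along `e` at every good `ℓ ≠ p` — is DISPLAYED as hypotheses: at `p = 2` it is the tree's
`HeckeThetaPartner.exists_grossencharakter_partner` (2-division cubic, cubic character — specific to `2`);
at odd `p` it is the object of the seat's brick list AH1–AH8 (memo `Lines/birth_acns-MEMO-w3-g9.md`), whose
two inputs with no counterpart at `2` are the ORIENTATION of `χ̄` at `p` (Lubin–Tate reciprocity) and — NOT
delivered by this socket, whose level is only bounded ABOVE by `|d_k|·N𝔪` — the level clause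
`max 2 (v_ℓ M) = max 2 (v_ℓ N_W)` of the registered-candidate stub (Carayol / Ogg–Saito territory).

* `heckeThetaPartner_of_arithmeticHalf` — per pair, any prime `p` with no ideal of norm `p` in `k`:
  the K0-shape conclusion `∃ M g ι Ω, p ∤ M ∧ IsNewform0 g ∧ IsCMForm g ∧ a_p(g) = 0 ∧
  IsCohomologicalPlusPeriod g ι Ω ∧ ∀ ℓ ∤ p·M·N_W, ‖ι a_ℓ(g) − a_ℓ(W)‖ < 1`, with moreover
  `M ∣ |d_k|·N𝔪` (so every prime of `M` is a bad prime of `W`).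
* `heckeThetaPartner_classwide_of_arithmeticHalf` — the class-wide form on crux L's domain (`p ≠ 2`,
  `ClassX7 W p`, `¬CM`, `a_p = 0`, `¬Surj`): if every pair carries an arithmetic half then every pair
  carries a K0-shape partner (the conclusion of `stub_heckeThetaPartner_ns` WITHOUT its level clause).

BSD, crux L and the stub are NOT proved by this file.

References: K. Ribet, LNM 601 (1977) §3 Thm. (3.4), Cor. (3.5); R. Pollack–T. Weston, Duke Math. J. 156
(2011) Def. 2.1; J.-P. Serre, Invent. Math. 15 (1972) §4.2 c).
-/

set_option autoImplicit false
set_option linter.dupNamespace false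

noncomputable section

open scoped NumberField
open NumberField IsDedekindDomain WeierstrassCurve
open Literature.NumberTheory.GaloisRepresentations Literature.NumberTheory.LFunctions
  Literature.NumberTheory.EllipticCurves Literature.NumberTheory.EllipticCurves.ModularForms
  Literature.NumberTheory.EllipticCurves.Rank1Residual Literature.NumberTheory.Automorphic

namespace Summit.BirchSwinnertonDyer.BirchSwinnertonDyer.Theorems.SmallImageLambdaLowerThreeNsThetaPartner

/-- **The `p`-adic Hecke theta partner from its arithmetic half** (socket).  Let `W/ℚ` be globally
minimal, `p` a prime, `k` an imaginary quadratic field with NO ideal of norm `p`, `σ : k → ℂ`, `𝔪 ≠ 0` an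
ideal of `𝓞 k` with `p ∤ |d_k|·N𝔪` and every prime factor of `|d_k|·N𝔪` a bad prime of `W`,
`e : ℚ̄_p ≃ ℂ`, and `ψ` a Größencharakter `mod 𝔪` of type `σ` with `ψ̃((n)) = (d_k/n)·n` for odd `n` prime
to `|d_k|·N𝔪` such that `‖e⁻¹(∑_{Nw = ℓ} ψ(w)) − a_ℓ(W)‖ < 1` at every good prime `ℓ ≠ p`.  Then there are a
level `M ∣ |d_k|·N𝔪` with `p ∤ M`, a CM newform `g ∈ S₂(Γ₀(M))` with `a_p(g) = 0`, an embedding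
`ι : K_g → ℚ̄_p` and a cohomological plus period `Ω` with `‖ι a_ℓ(g) − a_ℓ(W)‖ < 1` for every prime
`ℓ ∤ p·M·N_W`.  (Ribet's `g` has `a_ℓ(g) = ∑_{Nw=ℓ} ψ(w)` off `|d_k|·N𝔪`, an empty sum at `ℓ = p`;
`ι = e⁻¹|_{K_g}`.) [cite: Ribet1977Nebentypus, §3, Thm. (3.4) and Cor. (3.5) (LNM 601, pp. 34–35)]
[cite: PollackWeston2011MT, Def. 2.1] -/
theorem heckeThetaPartner_of_arithmeticHalf (W : WeierstrassCurve ℚ) [W.IsElliptic] [W.IsGloballyMinimal]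
    (p : ℕ) [Fact p.Prime] (k : Type) [Field k] [NumberField k] (hk2 : Module.finrank ℚ k = 2)
    (htc : IsTotallyComplex k) (σ : k →+* ℂ) (𝔪 : Ideal (𝓞 k)) (h𝔪 : 𝔪 ≠ ⊥)
    (ψ : HeightOneSpectrum (𝓞 k) → ℂ) (e : PadicAlgCl p ≃+* ℂ)
    (hnop : ∀ I : Ideal (𝓞 k), Ideal.absNorm I ≠ p)
    (hpD : ¬ p ∣ (discr k).natAbs * Ideal.absNorm 𝔪)
    (hbad : ∀ (ℓ : ℕ) [Fact ℓ.Prime], ℓ ∣ (discr k).natAbs * Ideal.absNorm 𝔪 → ¬ W.HasGoodReductionAtPrime ℓ)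
    (hψG : IsGrossencharakter 𝔪 (embType σ) (embTypeConj σ) ψ)
    (hneb : ∀ n : ℕ, Odd n → n.Coprime ((discr k).natAbs * Ideal.absNorm 𝔪) →
      idealPow k ψ (Ideal.span {(n : 𝓞 k)}) = (jacobiSym (discr k) n : ℂ) * (n : ℂ) ^ (2 - 1))
    (htrace : ∀ (ℓ : ℕ) [Fact ℓ.Prime], ℓ ≠ p → W.HasGoodReductionAtPrime ℓ →
      ‖e.symm (∑ᶠ (w : HeightOneSpectrum (𝓞 k)) (_ : Ideal.absNorm w.asIdeal = ℓ), ψ w) -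
        (W.frobeniusTrace ℓ : PadicAlgCl p)‖ < 1) :
    ∃ (M : ℕ) (_ : NeZero M) (g : CuspForm (CongruenceSubgroup.Gamma0 M) 2)
      (ι : coeffField g →+* PadicAlgCl p) (Ω : ℂ),
      M ∣ (discr k).natAbs * Ideal.absNorm 𝔪 ∧ ¬ p ∣ M ∧ IsNewform0 g ∧ IsCMForm (liftToGamma1 M 2 g) ∧
        cuspCoeff g p = 0 ∧ IsCohomologicalPlusPeriod g ι Ω ∧
        ∀ ℓ : ℕ, ℓ.Prime → ¬ ℓ ∣ p * M * W.conductorNorm ℤ →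
          ‖embCoeff g ι ℓ - (W.frobeniusTrace ℓ : PadicAlgCl p)‖ < 1 := by
  classical
  haveI := htc
  obtain ⟨N, hN, g, hNdvd, hnew, hcmf, hcoeff⟩ :=
    HeckeTheta.ribet_cmNewform_gamma0_two k hk2 htc σ 𝔪 h𝔪 ψ hψG (fun n hn hcop => hneb n hn hcop)
  -- `p ∤ N`
  have hpN : ¬ p ∣ N := fun h => hpD (h.trans hNdvd)
  -- the embedding `ι = e⁻¹|_{K_g}` and a cohomological period
  let ι : coeffField g →+* PadicAlgCl p := ((e.symm : ℂ ≃+* PadicAlgCl p) : ℂ →+* PadicAlgCl p).comp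
    (algebraMap (coeffField g) ℂ)
  have hι : ∀ n : ℕ, embCoeff g ι n = e.symm (cuspCoeff g n) := fun n => rfl
  obtain ⟨Ω, hΩ⟩ := CohomologicalPeriod.exists_isCohomologicalPlusPeriod hnew ι
  -- `a_p(g) = 0`: there is no prime of norm `p`
  have hap : cuspCoeff g p = 0 := by
    rw [hcoeff p Fact.out hpD]
    have hS : {v : HeightOneSpectrum (𝓞 k) | Ideal.absNorm v.asIdeal = p} = ∅ := by
      ext v; simp [hnop v.asIdeal]
    change ∑ᶠ v ∈ {v : HeightOneSpectrum (𝓞 k) | Ideal.absNorm v.asIdeal = p}, ψ v = 0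
    rw [hS, finsum_mem_empty]
  refine ⟨N, hN, g, ι, Ω, hNdvd, hpN, hnew, hcmf, hap, hΩ, fun ℓ hℓ hℓdvd => ?_⟩
  -- the congruence at `ℓ ∤ p N N_W`
  haveI : Fact ℓ.Prime := ⟨hℓ⟩
  have hℓp : ℓ ≠ p := by
    rintro rfl; exact hℓdvd (dvd_mul_of_dvd_left (dvd_mul_right ℓ N) _)
  have hℓNW : ¬ ℓ ∣ W.conductorNorm ℤ := fun h => hℓdvd (dvd_mul_of_dvd_right h _)
  have hgood : W.HasGoodReductionAtPrime ℓ := by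
    by_contra hb
    exact hℓNW ((W.dvd_conductorNorm_iff_not_hasGoodReductionAtPrime ℓ).mpr hb)
  have hℓD : ¬ ℓ ∣ (discr k).natAbs * Ideal.absNorm 𝔪 := fun h => hbad ℓ h hgood
  rw [hι, hcoeff ℓ hℓ hℓD]
  exact htrace ℓ hℓp hgood

/-- **Class-wide form on crux L's domain.**  If every small-image X7 pair at an odd prime (`p ≠ 2`,
`ClassX7 W p`, `¬CM`, `a_p = 0`, `¬ Surj W p`) carries an arithmetic half (as in
`heckeThetaPartner_of_arithmeticHalf`), then every such pair carries a `p`-adic Hecke theta partner: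
the conclusion of the candidate stub `Rtt.stub_heckeThetaPartner_ns` of `Lines/rtt_w3.lean` WITHOUT its
level clause `max 2 (v_ℓ M) = max 2 (v_ℓ N_W)` (which Ribet's bound `M ∣ |d_k|·N𝔪` cannot supply).
[cite: Ribet1977Nebentypus, §3, Thm. (3.4) and Cor. (3.5) (LNM 601, pp. 34–35)] -/
theorem heckeThetaPartner_classwide_of_arithmeticHalf
    (hAH : ∀ (W : WeierstrassCurve ℚ) [W.IsElliptic] [W.IsGloballyMinimal] (p : ℕ) [Fact p.Prime],
      p ≠ 2 → ClassX7 W p → ¬ W.HasCM → W.frobeniusTrace p = 0 → ¬ Surj W p →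
      ∃ (k : Type) (_ : Field k) (_ : NumberField k) (σ : k →+* ℂ) (𝔪 : Ideal (𝓞 k))
        (ψ : HeightOneSpectrum (𝓞 k) → ℂ) (e : PadicAlgCl p ≃+* ℂ),
        Module.finrank ℚ k = 2 ∧ IsTotallyComplex k ∧ 𝔪 ≠ ⊥ ∧
        (∀ I : Ideal (𝓞 k), Ideal.absNorm I ≠ p) ∧ ¬ p ∣ (discr k).natAbs * Ideal.absNorm 𝔪 ∧
        (∀ (ℓ : ℕ) [Fact ℓ.Prime], ℓ ∣ (discr k).natAbs * Ideal.absNorm 𝔪 → ¬ W.HasGoodReductionAtPrime ℓ) ∧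
        IsGrossencharakter 𝔪 (embType σ) (embTypeConj σ) ψ ∧
        (∀ n : ℕ, Odd n → n.Coprime ((discr k).natAbs * Ideal.absNorm 𝔪) →
          idealPow k ψ (Ideal.span {(n : 𝓞 k)}) = (jacobiSym (discr k) n : ℂ) * (n : ℂ) ^ (2 - 1)) ∧
        (∀ (ℓ : ℕ) [Fact ℓ.Prime], ℓ ≠ p → W.HasGoodReductionAtPrime ℓ →
          ‖e.symm (∑ᶠ (w : HeightOneSpectrum (𝓞 k)) (_ : Ideal.absNorm w.asIdeal = ℓ), ψ w) -
            (W.frobeniusTrace ℓ : PadicAlgCl p)‖ < 1)) :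
    ∀ (W : WeierstrassCurve ℚ) [W.IsElliptic] [W.IsGloballyMinimal] (p : ℕ) [Fact p.Prime],
      p ≠ 2 → ClassX7 W p → ¬ W.HasCM → W.frobeniusTrace p = 0 → ¬ Surj W p →
      ∃ (M : ℕ) (_ : NeZero M) (g : CuspForm (CongruenceSubgroup.Gamma0 M) 2)
        (ι : coeffField g →+* PadicAlgCl p) (Ω : ℂ),
        ¬ p ∣ M ∧ IsNewform0 g ∧ IsCMForm (liftToGamma1 M 2 g) ∧
          cuspCoeff g p = 0 ∧ IsCohomologicalPlusPeriod g ι Ω ∧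
          (∀ ℓ : ℕ, ℓ.Prime → ¬ ℓ ∣ p * M * W.conductorNorm ℤ →
            ‖embCoeff g ι ℓ - (W.frobeniusTrace ℓ : PadicAlgCl p)‖ < 1) := by
  intro W _ _ p _ hp hX hcm hap hs
  obtain ⟨k, _, _, σ, 𝔪, ψ, e, hk2, htc, h𝔪, hnop, hpD, hbad, hψG, hneb, htrace⟩ :=
    hAH W p hp hX hcm hap hs
  obtain ⟨M, hM, g, ι, Ω, -, hpM, hnew, hcmf, hapg, hΩ, hcong⟩ :=
    heckeThetaPartner_of_arithmeticHalf W p k hk2 htc σ 𝔪 h𝔪 ψ e hnop hpD (fun ℓ _ => hbad ℓ) hψG hneb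
      (fun ℓ _ => htrace ℓ)
  exact ⟨M, hM, g, ι, Ω, hpM, hnew, hcmf, hapg, hΩ, hcong⟩

end Summit.BirchSwinnertonDyer.BirchSwinnertonDyer.Theorems.SmallImageLambdaLowerThreeNsThetaPartner

end
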